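import Summits.ResolutionOfSingularities.ResolutionOfSingularities.Theorems.CouplingCutKernels
import Summits.ResolutionOfSingularities.ResolutionOfSingularities.Theorems.MaxContactCutFactorContact
import HarnessLib

/-!
# MaxContactCutCouplingCut — decomp-res node «CouplingCut» (lens-4 g18; CRITIC-LEDGER row 117 CLEARED:
DECIDED-MOD-PORT +1 cell)
refining the MaxContactCut aside 32260 (host of the lens-4 column).  Tree file 4/4 of the node.

Content VERBATIM from the decomp-res lens-4 cumulative file `HOME/decomp-res-lens-4/g18/CouplingCut.lean` (sha256
5bf7b2ca8f7311e8;
its §1–§6 = g14 HugValuationCut, ALREADY in the tree as `Theorems/HugValuationCut{Chains,Classes,Kernels}` +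
`MaxContactCutHugValuationCut`; §7–§12 = g15 «MarkingBudget» @369c12ac; §13–§17 = g16 «WeightDescent»
@1cb1c32f; §18–§23 = g17
«FactorContact» @daf245ab; §24–§31 = g18 «CouplingCut»).  HOME = run/shared/lean/pub/decomp-res.

Inside the Theses cone: §30 BY NAME — the strong induction on the weight with the g18 residual:
`MaxContactCut.ForcedTowersTerminate n` /
30253 / 32260 / 32203 / 31570 from (L,P,drift,bi-wild,incomm) and the lower cells modulo the COSTUME ports
(`forcedTowersTerminate_of_g18`,
`noForcedTowers_of_g18`, EXACT `noForcedTowers_iff_g18`, `noSingularSurfaceHuggingTowers_iff_g18`), necessity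
port-free; §31 the rider:
the located residual from 31258 `MaxContactCut.NoEventuallyFreeTowers` BY NAME and the recurrent residual
(`noIncommensurableWildDriftingTowers_of_tree`, `noForcedTowers_iff_g18'`).
[WRITER NOTE: the lens's trivial edge `noEventuallyFreeTowers_of_noForcedTowers` (30253 ⇒ 31258, audit
proof-of-item flag) is dropped per critic row 117 — its one use in `noForcedTowers_iff_g18'` is inlined
(`ftt_iff_free_satellite`).]

[WRITER NOTE (decomp-res writer g6): the whole lens-4 chain lives in ONE namespace `…Theorems.HugValuationCut` (the tree's g14
namespace) so that the lens's `HugChain.`/`HugShadow.`/`MarkedShadow.` dot-notation extends the landed structures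
verbatim; the lens's
`noTower_iff_perfect_and_imperfect` is the tree's `ContactShadowKernels.noTower_iff_columns`; `set_option` lines
dropped; cone-free
(no `Theses` import) so the route file can import it for asides; the BY-NAME wiring to the MaxContactCut items is in the
`MaxContactCut<Node>` companion files.]
(Sources: CossartJannsenSaito2020 Key Thm. 6.40, Cor. 6.37, Lem. 6.35/6.36; BierstoneGrigorievMilmanWlodarczyk2011
§3 (marked ideals, Lem. 3.2.1, §3.7); CossartPiltant2019; Abhyankar1956; Cutkosky2009 §2.1; Giraud1975
(Diff-lemma); EGAIV4 §16.8; BierstoneMilman1997; Wlodarczyk2005; Kollar2007 §3 (sums of marked ideals).)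
-/

noncomputable section

open CategoryTheory AlgebraicGeometry IsLocalRing
open Literature.AlgebraicGeometry.Resolution
open Summit.ResolutionOfSingularities.ResolutionOfSingularities.Theses
open Summit.ResolutionOfSingularities.ResolutionOfSingularities.Theorems
open WeakOrderReduction ForcedTowerClasses DivergentTowerClasses MonomialTowerClasses
open HugDimensionClasses HugDimensionKernels SurfaceShadowClasses SurfaceShadowKernels
open ContactShadowClasses (NoTowerImperfect)
open ContactShadowKernels (noTowerImperfect_of_noTower noTowerImperfect_mono noTower_iff_columns)
open NearPointCut (SingularClass singularSurface_iff_noTower)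
open AbsoluteContactClasses (IsAbsContactAt)

namespace Summit.ResolutionOfSingularities.ResolutionOfSingularities.Theorems.HugValuationCut

variable {K : Type} [Field K]

/-! ## §30 (g18 · NEW) Up to the booked MaxContactCut items BY NAME — all weights (the strong induction on the weight, the
commensurable cells fed back into it) -/

/-- **THE ROOT PIECE AT EVERY WEIGHT** (strong induction on the weight; the commensurable cells descend to the coupled
weight `max(ν, n − ν) < n`). [folklore] -/
theorem forcedTowersTerminate_of_g18 (hMo : MaxContactCut.MonomialCornerAll) (hC : MaxContactCut.CurveLawAll)
    (hSL : MaxContactCut.SurfaceLawAll) (hH : MaxContactCut.NoHypersurfaceHuggingTowers) (hP : ShadowPortAll)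
    (hM : MarkingPortAll) (hDesc : DescentPortAll) (hFC : FactorContactPortAll) (hCo : CouplingPortAll)
    (hO : NoOffLocusShadowTowers) (hNP : NoNonPrincipalInLocusTowers) (hPu : NoPurePrincipalTowers)
    (hR : NoIncommensurableWildDriftingTowers) : ∀ n : ℕ, 1 ≤ n → ForcedTowersTerminate n := by
  intro n
  induction n using Nat.strong_induction_on with
  | _ n ih =>
    intro hn
    exact ftt_step_of_g18 hn (hMo n hn) (hC n hn) (hSL n hn) (hH n hn) (hP n hn) (hM n hn) (hDesc n hn) (hFC n hn)
      (hCo n hn) (hO n hn) (hNP n hn) (hPu n hn) (hR n hn) fun n' h1 h2 => ih n' h2 h1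

/-- **30253 `MaxContactCut.NoForcedTowers` BY NAME.** [folklore] -/
theorem noForcedTowers_of_g18 (hMo : MaxContactCut.MonomialCornerAll) (hC : MaxContactCut.CurveLawAll)
    (hSL : MaxContactCut.SurfaceLawAll) (hH : MaxContactCut.NoHypersurfaceHuggingTowers) (hP : ShadowPortAll)
    (hM : MarkingPortAll) (hDesc : DescentPortAll) (hFC : FactorContactPortAll) (hCo : CouplingPortAll)
    (hO : NoOffLocusShadowTowers) (hNP : NoNonPrincipalInLocusTowers) (hPu : NoPurePrincipalTowers)
    (hR : NoIncommensurableWildDriftingTowers) : MaxContactCut.NoForcedTowers :=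
  forcedTowersTerminate_of_g18 hMo hC hSL hH hP hM hDesc hFC hCo hO hNP hPu hR

/-- g17's residual over all weights from the ports and the incommensurable residual (lower weights from the
induction). [folklore] -/
theorem noWildDriftingTowers_of_g18 (hMo : MaxContactCut.MonomialCornerAll) (hC : MaxContactCut.CurveLawAll)
    (hSL : MaxContactCut.SurfaceLawAll) (hH : MaxContactCut.NoHypersurfaceHuggingTowers) (hP : ShadowPortAll)
    (hM : MarkingPortAll) (hDesc : DescentPortAll) (hFC : FactorContactPortAll) (hCo : CouplingPortAll)
    (hO : NoOffLocusShadowTowers) (hNP : NoNonPrincipalInLocusTowers) (hPu : NoPurePrincipalTowers)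
    (hR : NoIncommensurableWildDriftingTowers) : NoWildDriftingTowers :=
  fun n hn => wildDrifting_of_g18 (hCo n hn)
    (fun n' h1 _ => forcedTowersTerminate_of_g18 hMo hC hSL hH hP hM hDesc hFC hCo hO hNP hPu hR n' h1) (hR n hn)

/-- the commensurable impure cell over all weights is EMPTY (ports, residual, induction). [folklore] -/
theorem noCommensurableImpureTowers_of_g18 (hMo : MaxContactCut.MonomialCornerAll) (hC : MaxContactCut.CurveLawAll)
    (hSL : MaxContactCut.SurfaceLawAll) (hH : MaxContactCut.NoHypersurfaceHuggingTowers) (hP : ShadowPortAll)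
    (hM : MarkingPortAll) (hDesc : DescentPortAll) (hFC : FactorContactPortAll) (hCo : CouplingPortAll)
    (hO : NoOffLocusShadowTowers) (hNP : NoNonPrincipalInLocusTowers) (hPu : NoPurePrincipalTowers)
    (hR : NoIncommensurableWildDriftingTowers) : NoCommensurableImpureTowers :=
  fun n hn => commensurableImpure_of_port (hCo n hn)
    fun n' h1 _ => forcedTowersTerminate_of_g18 hMo hC hSL hH hP hM hDesc hFC hCo hO hNP hPu hR n' h1

/-- **THE HOST TARGET 32260 `MaxContactCut.NoSingularSurfaceHuggingTowers` BY NAME.** [folklore] -/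
theorem noSingularSurfaceHuggingTowers_of_g18 (hMo : MaxContactCut.MonomialCornerAll) (hC : MaxContactCut.CurveLawAll)
    (hSL : MaxContactCut.SurfaceLawAll) (hH : MaxContactCut.NoHypersurfaceHuggingTowers) (hP : ShadowPortAll)
    (hM : MarkingPortAll) (hDesc : DescentPortAll) (hFC : FactorContactPortAll) (hCo : CouplingPortAll)
    (hO : NoOffLocusShadowTowers) (hNP : NoNonPrincipalInLocusTowers) (hPu : NoPurePrincipalTowers)
    (hR : NoIncommensurableWildDriftingTowers) : MaxContactCut.NoSingularSurfaceHuggingTowers :=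
  noSingularSurfaceHuggingTowers_of_g17 hMo hC hSL hH hP hM hDesc hFC hO hNP hPu
    (noWildDriftingTowers_of_g18 hMo hC hSL hH hP hM hDesc hFC hCo hO hNP hPu hR)

/-- **32203 `MaxContactCut.NoSurfaceHuggingTowers` BY NAME.** [folklore] -/
theorem noSurfaceHuggingTowers_of_g18 (hMo : MaxContactCut.MonomialCornerAll) (hC : MaxContactCut.CurveLawAll)
    (hSL : MaxContactCut.SurfaceLawAll) (hH : MaxContactCut.NoHypersurfaceHuggingTowers) (hP : ShadowPortAll)
    (hM : MarkingPortAll) (hDesc : DescentPortAll) (hFC : FactorContactPortAll) (hCo : CouplingPortAll)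
    (hO : NoOffLocusShadowTowers) (hNP : NoNonPrincipalInLocusTowers) (hPu : NoPurePrincipalTowers)
    (hR : NoIncommensurableWildDriftingTowers) : MaxContactCut.NoSurfaceHuggingTowers :=
  noSurfaceHuggingTowers_of_g17 hMo hC hSL hH hP hM hDesc hFC hO hNP hPu
    (noWildDriftingTowers_of_g18 hMo hC hSL hH hP hM hDesc hFC hCo hO hNP hPu hR)

/-- **31570 `MaxContactCut.NoHuggingTowers` BY NAME.** [folklore] -/
theorem noHuggingTowers_of_g18 (hMo : MaxContactCut.MonomialCornerAll) (hC : MaxContactCut.CurveLawAll)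
    (hSL : MaxContactCut.SurfaceLawAll) (hH : MaxContactCut.NoHypersurfaceHuggingTowers) (hP : ShadowPortAll)
    (hM : MarkingPortAll) (hDesc : DescentPortAll) (hFC : FactorContactPortAll) (hCo : CouplingPortAll)
    (hO : NoOffLocusShadowTowers) (hNP : NoNonPrincipalInLocusTowers) (hPu : NoPurePrincipalTowers)
    (hR : NoIncommensurableWildDriftingTowers) : MaxContactCut.NoHuggingTowers :=
  noHuggingTowers_of_g17 hMo hC hSL hH hP hM hDesc hFC hO hNP hPu
    (noWildDriftingTowers_of_g18 hMo hC hSL hH hP hM hDesc hFC hCo hO hNP hPu hR)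

/-- Necessity, port-free: 32260 implies the incommensurable residual over all weights. [folklore] -/
theorem noIncommensurableWildDriftingTowers_of_item (h : MaxContactCut.NoSingularSurfaceHuggingTowers) :
    NoIncommensurableWildDriftingTowers :=
  fun n hn => incommensurableWildDrifting_of_singularSurface (h n hn)

/-- Necessity, port-free: 30253 implies the incommensurable residual over all weights. [folklore] -/
theorem noIncommensurableWildDriftingTowers_of_noForcedTowers (h : MaxContactCut.NoForcedTowers) :
    NoIncommensurableWildDriftingTowers :=
  fun n hn => incommensurableWildDrifting_of_wildDrifting (noWildDriftingTowers_of_noForcedTowers h n hn)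

/-- **EXACT AT THE ROOT 30253 modulo the decided pieces and the five COSTUME ports**:
`MaxContactCut.NoForcedTowers ⟺ (O) ∧ (L,¬P) ∧ (L,P,pure) ∧ (L,P,drift,wild,INCOMM)` over all weights. [folklore] -/
theorem noForcedTowers_iff_g18 (hMo : MaxContactCut.MonomialCornerAll) (hC : MaxContactCut.CurveLawAll)
    (hSL : MaxContactCut.SurfaceLawAll) (hH : MaxContactCut.NoHypersurfaceHuggingTowers) (hP : ShadowPortAll)
    (hM : MarkingPortAll) (hDesc : DescentPortAll) (hFC : FactorContactPortAll) (hCo : CouplingPortAll) :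
    MaxContactCut.NoForcedTowers ↔
      NoOffLocusShadowTowers ∧ NoNonPrincipalInLocusTowers ∧ NoPurePrincipalTowers ∧
        NoIncommensurableWildDriftingTowers :=
  ⟨fun h => ⟨(residuals_of_noForcedTowers h).1, (residuals_of_noForcedTowers h).2.1,
    (residuals_of_noForcedTowers h).2.2.1, noIncommensurableWildDriftingTowers_of_noForcedTowers h⟩,
    fun h => noForcedTowers_of_g18 hMo hC hSL hH hP hM hDesc hFC hCo h.1 h.2.1 h.2.2.1 h.2.2.2⟩

/-- **EXACT AT THE HOST 32260 modulo the decided pieces and the ports** (through the root induction). [folklore] -/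
theorem noSingularSurfaceHuggingTowers_iff_g18 (hMo : MaxContactCut.MonomialCornerAll) (hC : MaxContactCut.CurveLawAll)
    (hSL : MaxContactCut.SurfaceLawAll) (hH : MaxContactCut.NoHypersurfaceHuggingTowers) (hP : ShadowPortAll)
    (hM : MarkingPortAll) (hDesc : DescentPortAll) (hFC : FactorContactPortAll) (hCo : CouplingPortAll) :
    MaxContactCut.NoSingularSurfaceHuggingTowers ↔
      NoOffLocusShadowTowers ∧ NoNonPrincipalInLocusTowers ∧ NoPurePrincipalTowers ∧
        NoIncommensurableWildDriftingTowers :=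
  ⟨fun h => ⟨noOffLocusShadowTowers_of_item h, noNonPrincipalInLocusTowers_of_item h, noPurePrincipalTowers_of_item h,
    noIncommensurableWildDriftingTowers_of_item h⟩,
    fun h => noSingularSurfaceHuggingTowers_of_g18 hMo hC hSL hH hP hM hDesc hFC hCo h.1 h.2.1 h.2.2.1 h.2.2.2⟩

/-! ## §31 (g18 · NEW, rider) The RECURRENCE axis on the located residual: its eventually-free part is the tree item
31258 `MaxContactCut.NoEventuallyFreeTowers` BY NAME (the hugging column dropped satellite-recurrence at
`MonomialTowerClasses.HuggingTowersTerminate := NoTower n GermHugging`; it is re-imported here, port-free) -/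

/-- the located residual over all weights from 31258 `MaxContactCut.NoEventuallyFreeTowers` BY NAME and the recurrent
residual. [folklore] -/
theorem noIncommensurableWildDriftingTowers_of_tree (h : MaxContactCut.NoEventuallyFreeTowers)
    (hRec : NoRecurrentIncommensurableWildDriftingTowers) : NoIncommensurableWildDriftingTowers :=
  fun n hn => incommensurableWildDrifting_of_recurrent (h n hn) (hRec n hn)

/-- Necessity, port-free: 32260 implies the recurrent residual. [folklore] -/
theorem noRecurrentIncommensurableWildDriftingTowers_of_item (h : MaxContactCut.NoSingularSurfaceHuggingTowers) :
    NoRecurrentIncommensurableWildDriftingTowers :=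
  fun n hn => (incommensurableWildDrifting_iff_free_recurrent.mp (noIncommensurableWildDriftingTowers_of_item h n hn)).2

/-- **THE HOST 32260 BY NAME from 31258 BY NAME, the five ports, the decided pieces and the RECURRENT residual.** [folklore] -/
theorem noSingularSurfaceHuggingTowers_of_g18' (hMo : MaxContactCut.MonomialCornerAll) (hC : MaxContactCut.CurveLawAll)
    (hSL : MaxContactCut.SurfaceLawAll) (hH : MaxContactCut.NoHypersurfaceHuggingTowers) (hP : ShadowPortAll)
    (hM : MarkingPortAll) (hDesc : DescentPortAll) (hFC : FactorContactPortAll) (hCo : CouplingPortAll)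
    (hO : NoOffLocusShadowTowers) (hNP : NoNonPrincipalInLocusTowers) (hPu : NoPurePrincipalTowers)
    (hEF : MaxContactCut.NoEventuallyFreeTowers) (hRec : NoRecurrentIncommensurableWildDriftingTowers) :
    MaxContactCut.NoSingularSurfaceHuggingTowers :=
  noSingularSurfaceHuggingTowers_of_g18 hMo hC hSL hH hP hM hDesc hFC hCo hO hNP hPu
    (noIncommensurableWildDriftingTowers_of_tree hEF hRec)

/-- **EXACT AT THE ROOT 30253 with 31258 as a booked conjunct**:
`NoForcedTowers ⟺ (O) ∧ (L,¬P) ∧ (L,P,pure) ∧ 31258 ∧ (L,P,drift,wild,incomm,RECURRENT)`. [folklore] -/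
theorem noForcedTowers_iff_g18' (hMo : MaxContactCut.MonomialCornerAll) (hC : MaxContactCut.CurveLawAll)
    (hSL : MaxContactCut.SurfaceLawAll) (hH : MaxContactCut.NoHypersurfaceHuggingTowers) (hP : ShadowPortAll)
    (hM : MarkingPortAll) (hDesc : DescentPortAll) (hFC : FactorContactPortAll) (hCo : CouplingPortAll) :
    MaxContactCut.NoForcedTowers ↔
      NoOffLocusShadowTowers ∧ NoNonPrincipalInLocusTowers ∧ NoPurePrincipalTowers ∧
        MaxContactCut.NoEventuallyFreeTowers ∧ NoRecurrentIncommensurableWildDriftingTowers :=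
  ⟨fun h => ⟨(residuals_of_noForcedTowers h).1, (residuals_of_noForcedTowers h).2.1,
    (residuals_of_noForcedTowers h).2.2.1, fun n hn => (ftt_iff_free_satellite.mp (h n hn)).1,
    fun n hn => (incommensurableWildDrifting_iff_free_recurrent.mp
      (noIncommensurableWildDriftingTowers_of_noForcedTowers h n hn)).2⟩,
    fun h => noForcedTowers_of_g18 hMo hC hSL hH hP hM hDesc hFC hCo h.1 h.2.1 h.2.2.1
      (noIncommensurableWildDriftingTowers_of_tree h.2.2.2.1 h.2.2.2.2)⟩

end Summit.ResolutionOfSingularities.ResolutionOfSingularities.Theorems.HugValuationCut
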